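import Literature.Geometry.Kaehler.ChartL2
import Literature.Geometry.Kaehler.PullbackFamilyChart
import Literature.Geometry.Kaehler.L2InnerTransport
import Literature.NumberTheory.Transcendental.KaehlerHodgePreHilbert
import Literature.NumberTheory.Transcendental.L2HodgeTheoryLaplacianProofs
import Literature.NumberTheory.Transcendental.FormIntegrationBridgeProofs
import Mathlib.Analysis.Complex.OperatorNorm
import HarnessLib

/-!
# A smooth family of pulled-back forms is locally Lipschitz in `L²`:
# `‖Ψ_p^* Ξ - Ψ_t^* Ξ‖_{L²(M)} ≤ C ‖p - t‖`

Topic: the `L²` metric on the forms of a compact oriented Riemannian manifold (Warner (1983), 6.1,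
6.33) in a `C^∞` family (Voisin (2002), §9.1.1, §10.2.2). Theorems only, no definition, no named
fact. Written by the prover seat `hodge-nonav-prover-Bx` (g17, cell `hodge-nonav`) as brick **K5b**
of the programme «GRIFFITHS-HOLOMORPHY» (memo `PROGRAMME-GRIFFITHS-HOLOMORPHY-Bx-g17.md`).

Let `M` be a compact manifold (model `EM`, smooth Riemannian metric, orientation family `o` with
smooth volume form), `Ψ : P → M → T` a family of maps into a manifold `T` which is jointly `C^∞`
on `U × M` (`U ⊆ P` open, `P` a finite-dimensional real normed space), and `Ξ` a smooth complex
`k`-form on `T`. Then near every `t ∈ U` the `L²` norm of `Ψ_p^* Ξ - Ψ_t^* Ξ` is `O(‖p - t‖)`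
(`exists_forall_norm_mk_pullback_sub_le`). Proof (Warner 6.33 pointwise, then integrate): in a
chart of `M` at `x₀` the pointwise inner product is the positive weight `innerChart`
(`MForm.inner_eq_innerChart`), bounded by `c₂ ‖·‖²` on compact sets (`exists_innerChart_bounds`);
the chart representative `(p, y) ↦ (Ψ_p^*Ξ)^(y)` is jointly `C^∞` (`contDiffAt_inChart_pullback_family`),
hence Lipschitz in `p` on compact sets (mean value inequality); finitely many charts cover `M`;
and `∫_M f vol ≤ (sup f) ∫_M vol` (positivity of `∫`, Lee Prop. 16.6 (c)).

* `sum_inner_le_of_forall` / `l2Inner_add_l2Inner_le_of_forall_le` — `∫` of a pointwise bound;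
* `exists_forall_inner_pullback_sub_le` — the uniform pointwise bound `⟪D,D⟫_x ≤ C ‖p - t‖²`,
  `D = Ψ_p^*Ξ - Ψ_t^*Ξ` (real and imaginary parts);
* `exists_forall_norm_mk_pullback_sub_le` — the `L²` Lipschitz bound.

## References

* F. W. Warner, *Foundations of Differentiable Manifolds and Lie Groups*, GTM 94 (1983), 6.1, 6.33. [WarnerGTM94]
* C. Voisin, *Hodge Theory and Complex Algebraic Geometry I*, CUP (2002), §9.1.1, §10.2.2. [VoisinHodgeI2002]
* J. M. Lee, *Introduction to Smooth Manifolds*, 2nd ed. (2013), Prop. 16.6, Lemma 14.16. [LeeSmoothManifolds2013]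
-/

noncomputable section

open scoped Manifold ContDiff Topology
open Bundle Module Set Filter Function Metric
open Literature.NumberTheory.Transcendental

namespace Literature.Geometry.Kaehler

-- `TangentSpace I x = E` silently, as in the tree's form files.
set_option backward.isDefEq.respectTransparency false

variable {EM : Type*} [NormedAddCommGroup EM] [NormedSpace ℂ EM] [FiniteDimensional ℂ EM]
  [MeasurableSpace EM] [BorelSpace EM] {N : ℕ} [Fact (finrank ℝ EM = N)]
  {M : Type*} [TopologicalSpace M] [ChartedSpace EM M] [IsManifold 𝓘(ℝ, EM) ∞ M]
  [T2Space M] [CompactSpace M]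
  [RiemannianBundle (fun x : M ↦ TangentSpace 𝓘(ℝ, EM) x)]
  [IsContMDiffRiemannianBundle 𝓘(ℝ, EM) ∞ EM (fun x : M ↦ TangentSpace 𝓘(ℝ, EM) x)]
  (o : (x : M) → Orientation ℝ (TangentSpace 𝓘(ℝ, EM) x) (Fin N))
  {ET : Type*} [NormedAddCommGroup ET] [NormedSpace ℝ ET]
  {HT : Type*} [TopologicalSpace HT] {IT : ModelWithCorners ℝ ET HT}
  {T : Type*} [TopologicalSpace T] [ChartedSpace HT T] [IsManifold IT ∞ T]
  {P : Type*} [NormedAddCommGroup P] [NormedSpace ℝ P] [FiniteDimensional ℝ P]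

/-! ### Integrating a pointwise bound -/

/-- **`∫_M f vol ≤ C ∫_M vol` for a smooth density `f ≤ C`** (positivity and linearity of `∫_M` on
smooth top forms, Lee (2013), Prop. 16.6 (a), (c)). [cite: LeeSmoothManifolds2013, Prop. 16.6] -/
theorem integral_smul_volumeForm_le_of_forall_le (ho : IsSmoothForm (riemannianVolumeForm o))
    {f : M → ℝ} (hf : IsSmoothForm (fun x ↦ f x • riemannianVolumeForm o x)) {C : ℝ}
    (hle : ∀ x, f x ≤ C) :
    MForm.integral o (fun x ↦ f x • riemannianVolumeForm o x) ≤
      C * MForm.integral o (riemannianVolumeForm o) := by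
  haveI : IsContinuousRiemannianBundle EM (fun x : M ↦ TangentSpace 𝓘(ℝ, EM) x) :=
    isContinuousRiemannianBundle_of_isContMDiffRiemannianBundle 𝓘(ℝ, EM) ∞
  have hoc : IsContinuousOrientation o :=
    isContinuousOrientation_of_isSmoothForm_riemannianVolumeForm_holds o ho
  -- `0 ≤ ∫ (C - f) vol`
  have hpos := integral_smul_riemannianVolumeForm_nonneg_holds o (f := fun x ↦ C - f x)
    (fun x ↦ sub_nonneg.2 (hle x))
  have hCs : IsSmoothForm (fun x ↦ C • riemannianVolumeForm o x) := ho.smul C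
  have hneg : IsSmoothForm (fun x ↦ (-1 : ℝ) • (f x • riemannianVolumeForm o x)) := hf.smul (-1)
  have hsplit : (fun x ↦ (C - f x) • riemannianVolumeForm o x) =
      (fun x ↦ C • riemannianVolumeForm o x) + fun x ↦ (-1 : ℝ) • (f x • riemannianVolumeForm o x) := by
    funext x
    simp only [Pi.add_apply, neg_one_smul]
    rw [sub_smul, sub_eq_add_neg]
  rw [hsplit, MForm.integral_add_holds (o := o) hoc hCs hneg] at hpos
  have h1 : MForm.integral o (fun x ↦ C • riemannianVolumeForm o x) =
      C * MForm.integral o (riemannianVolumeForm o) := MForm.integral_smul o C _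
  have h2 : MForm.integral o (fun x ↦ (-1 : ℝ) • (f x • riemannianVolumeForm o x)) =
      (-1) * MForm.integral o (fun x ↦ f x • riemannianVolumeForm o x) := MForm.integral_smul o (-1) _
  rw [h1, h2] at hpos
  linarith

/-- **`⟪a, a⟫_{L²} + ⟪b, b⟫_{L²} ≤ C ∫_M vol` from a pointwise bound `⟪a,a⟫_x + ⟪b,b⟫_x ≤ C`** for
smooth real `k`-forms `a, b` (the case `a = Re γ`, `b = Im γ` gives `‖γ‖²_{L²} ≤ C ∫ vol`).
[cite: WarnerGTM94, 6.1 (5), p. 220] -/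
theorem l2Inner_add_l2Inner_le_of_forall_le (ho : IsSmoothForm (riemannianVolumeForm o)) {k m : ℕ}
    (h : k + m = N) {a b : MForm 𝓘(ℝ, EM) M ℝ k} (ha : IsSmoothForm a) (hb : IsSmoothForm b) {C : ℝ}
    (hle : ∀ x, MForm.inner N a a x + MForm.inner N b b x ≤ C) :
    MForm.l2Inner o a a + MForm.l2Inner o b b ≤ C * MForm.integral o (riemannianVolumeForm o) := by
  haveI : IsContinuousRiemannianBundle EM (fun x : M ↦ TangentSpace 𝓘(ℝ, EM) x) :=
    isContinuousRiemannianBundle_of_isContMDiffRiemannianBundle 𝓘(ℝ, EM) ∞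
  have hoc : IsContinuousOrientation o :=
    isContinuousOrientation_of_isSmoothForm_riemannianVolumeForm_holds o ho
  have hsa := isSmoothForm_inner_smul_riemannianVolumeForm o ho h ha ha
  have hsb := isSmoothForm_inner_smul_riemannianVolumeForm o ho h hb hb
  have hsum : IsSmoothForm (fun x ↦ (MForm.inner N a a x + MForm.inner N b b x) • riemannianVolumeForm o x) := by
    have : (fun x ↦ (MForm.inner N a a x + MForm.inner N b b x) • riemannianVolumeForm o x) =
        (fun x ↦ MForm.inner N a a x • riemannianVolumeForm o x) +
          fun x ↦ MForm.inner N b b x • riemannianVolumeForm o x := by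
      funext x; simp only [Pi.add_apply, add_smul]
    rw [this]; exact hsa.add hsb
  have hint := integral_smul_volumeForm_le_of_forall_le o ho hsum hle
  have hsplit : (fun x ↦ (MForm.inner N a a x + MForm.inner N b b x) • riemannianVolumeForm o x) =
      (fun x ↦ MForm.inner N a a x • riemannianVolumeForm o x) +
        fun x ↦ MForm.inner N b b x • riemannianVolumeForm o x := by
    funext x; simp only [Pi.add_apply, add_smul]
  rw [hsplit, MForm.integral_add_holds (o := o) hoc hsa hsb] at hint
  exact hint

/-! ### The pointwise bound for a smooth family of pulled-back forms -/

set_option synthInstance.maxHeartbeats 200000 in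
omit [MeasurableSpace EM] [BorelSpace EM] [T2Space M] [CompactSpace M] in
/-- **Local pointwise Lipschitz bound** (one chart): for `x₀ ∈ M` and `t ∈ U` there are a
neighbourhood `V` of `x₀`, `δ > 0` and `C` such that for `‖p - t‖ ≤ δ` and `x ∈ V`,
`⟪Re D, Re D⟫_x + ⟪Im D, Im D⟫_x ≤ C ‖p - t‖²`, `D = Ψ_p^*Ξ - Ψ_t^*Ξ` — the chart weight is
`≤ c₂ ‖·‖²` on a compact ball (`exists_innerChart_bounds`) and the chart representative
`(p, y) ↦ (Ψ_p^*Ξ)^(y)` is jointly `C¹`, hence Lipschitz in `p` on compact sets (mean value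
inequality). [cite: WarnerGTM94, 6.33] -/
theorem exists_forall_inner_pullback_sub_le_local [IT.Boundaryless] {Ψ : P → M → T} {U : Set P}
    (hU : IsOpen U) {t : P} (ht : t ∈ U)
    (hΨ : ∀ p ∈ U, ∀ x, ContMDiffAt (𝓘(ℝ, P).prod 𝓘(ℝ, EM)) IT ∞ (uncurry Ψ) (p, x))
    {k : ℕ} {Ξ : MForm IT T ℂ k} (hΞ : IsSmoothForm Ξ) (x₀ : M) :
    ∃ V ∈ 𝓝 x₀, ∃ δ > (0 : ℝ), ∃ C : ℝ, ∀ p, ‖p - t‖ ≤ δ → ∀ x ∈ V,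
      MForm.inner N (Ξ.pullback 𝓘(ℝ, EM) (Ψ p) - Ξ.pullback 𝓘(ℝ, EM) (Ψ t)).re
          (Ξ.pullback 𝓘(ℝ, EM) (Ψ p) - Ξ.pullback 𝓘(ℝ, EM) (Ψ t)).re x +
        MForm.inner N (Ξ.pullback 𝓘(ℝ, EM) (Ψ p) - Ξ.pullback 𝓘(ℝ, EM) (Ψ t)).im
          (Ξ.pullback 𝓘(ℝ, EM) (Ψ p) - Ξ.pullback 𝓘(ℝ, EM) (Ψ t)).im x ≤ C * ‖p - t‖ ^ 2 := by
  haveI : FiniteDimensional ℝ EM := FiniteDimensional.complexToReal EM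
  haveI : ProperSpace EM := FiniteDimensional.proper ℝ EM
  haveI : ProperSpace P := FiniteDimensional.proper ℝ P
  set c := extChartAt 𝓘(ℝ, EM) x₀ with hc
  -- a closed chart ball around `c x₀` inside the target, and a closed parameter ball inside `U`
  obtain ⟨r, hr, hrK⟩ := Metric.nhds_basis_closedBall.mem_iff.1
    ((isOpen_extChartAt_target (I := 𝓘(ℝ, EM)) x₀).mem_nhds (mem_extChartAt_target (I := 𝓘(ℝ, EM)) x₀))
  obtain ⟨δ, hδ, hδU⟩ := Metric.nhds_basis_closedBall.mem_iff.1 (hU.mem_nhds ht)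
  set K : Set EM := closedBall (c x₀) r with hK
  have hKc : IsCompact K := isCompact_closedBall _ _
  have hKt : K ⊆ c.target := hrK
  -- the chart weight bound
  obtain ⟨c₁, c₂, -, hc₂⟩ :=
    exists_innerChart_bounds (E := EM) (H := EM) (I := 𝓘(ℝ, EM)) (M := M) (n := N) (k := k) x₀ hKc hKt
  -- the chart representative of the family, jointly `C^∞` on `U × target`
  set F : P × EM → EM [⋀^Fin k]→L[ℝ] ℂ := fun q ↦ (Ξ.pullback 𝓘(ℝ, EM) (Ψ q.1)).inChart x₀ q.2 with hF
  have hFd : ∀ q ∈ U ×ˢ c.target, ContDiffAt ℝ ∞ F q := by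
    rintro ⟨p, y⟩ ⟨hp, hy⟩
    refine contDiffAt_inChart_pullback_family (I := 𝓘(ℝ, EM)) (I' := IT) hΞ hy ?_
    have h1 : ∀ᶠ q' : P × M in 𝓝 (p, c.symm y), q'.1 ∈ U :=
      continuousAt_fst.preimage_mem_nhds (hU.mem_nhds hp)
    exact h1.mono fun q' hq' ↦ hΨ q'.1 hq' q'.2
  have hopen : IsOpen (U ×ˢ c.target) := hU.prod (isOpen_extChartAt_target (I := 𝓘(ℝ, EM)) x₀)
  have hFon : ContDiffOn ℝ 1 F (U ×ˢ c.target) := fun q hq ↦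
    ((hFd q hq).of_le (by exact_mod_cast le_top)).contDiffWithinAt
  have hF'c : ContinuousOn (fderiv ℝ F) (U ×ˢ c.target) :=
    hFon.continuousOn_fderiv_of_isOpen hopen le_rfl
  -- bound of the derivative on the compact `closedBall t δ × K`
  set S : Set (P × EM) := closedBall t δ ×ˢ K with hS
  have hSc : IsCompact S := (isCompact_closedBall _ _).prod hKc
  have hSU : S ⊆ U ×ˢ c.target := Set.prod_mono hδU hKt
  obtain ⟨L, hL⟩ := hSc.exists_bound_of_continuousOn
    (E := P × EM →L[ℝ] EM [⋀^Fin k]→L[ℝ] ℂ) (f := fderiv ℝ F) (hF'c.mono hSU)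
  have hSconv : Convex ℝ S := (convex_closedBall _ _).prod (convex_closedBall _ _)
  have hLip : ∀ p, ‖p - t‖ ≤ δ → ∀ y ∈ K, ‖F (p, y) - F (t, y)‖ ≤ L * ‖p - t‖ := by
    intro p hp y hy
    have hps : (p, y) ∈ S := ⟨mem_closedBall.2 (by rwa [dist_eq_norm]), hy⟩
    have hts : (t, y) ∈ S := ⟨mem_closedBall_self hδ.le, hy⟩
    have h := hSconv.norm_image_sub_le_of_norm_fderiv_le
      (fun q hq ↦ (hFd q (hSU hq)).differentiableAt (by simp)) (fun q hq ↦ hL q hq) hts hps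
    have hn : ‖((p, y) : P × EM) - (t, y)‖ = ‖p - t‖ := by
      rw [Prod.mk_sub_mk, sub_self, Prod.norm_mk, norm_zero, max_eq_left (norm_nonneg _)]
    rwa [hn] at h
  -- the neighbourhood `V = c⁻¹(K) ∩ source`
  refine ⟨c.source ∩ c ⁻¹' K, ?_, δ, hδ, (max c₂ 0) * (L ^ 2 + L ^ 2), fun p hp x hx ↦ ?_⟩
  · exact Filter.inter_mem (extChartAt_source_mem_nhds x₀)
      ((continuousAt_extChartAt x₀).preimage_mem_nhds (closedBall_mem_nhds _ hr))
  obtain ⟨hxs, hxK⟩ := hx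
  set y := c x with hy
  have hyK : y ∈ K := hxK
  have hyt : y ∈ c.target := hKt hyK
  have hxy : c.symm y = x := c.left_inv hxs
  set D := Ξ.pullback 𝓘(ℝ, EM) (Ψ p) - Ξ.pullback 𝓘(ℝ, EM) (Ψ t) with hD
  -- chart representatives of `Re D`, `Im D`
  have hDre : D.re.inChart x₀ y = Complex.reCLM.compContinuousAlternatingMap (F (p, y) - F (t, y)) := by
    rw [MForm.inChart_re]
    change Complex.reCLM.compContinuousAlternatingMap ((Ξ.pullback 𝓘(ℝ, EM) (Ψ p) -
      Ξ.pullback 𝓘(ℝ, EM) (Ψ t)).inChart x₀ y) = _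
    rfl
  have hDim : D.im.inChart x₀ y = Complex.imCLM.compContinuousAlternatingMap (F (p, y) - F (t, y)) := by
    rw [MForm.inChart_im]
    change Complex.imCLM.compContinuousAlternatingMap ((Ξ.pullback 𝓘(ℝ, EM) (Ψ p) -
      Ξ.pullback 𝓘(ℝ, EM) (Ψ t)).inChart x₀ y) = _
    rfl
  have hre_norm : ‖D.re.inChart x₀ y‖ ≤ ‖F (p, y) - F (t, y)‖ := by
    rw [hDre]
    refine (ContinuousLinearMap.norm_compContinuousAlternatingMap_le _ _).trans ?_
    rw [Complex.reCLM_norm, one_mul]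
  have him_norm : ‖D.im.inChart x₀ y‖ ≤ ‖F (p, y) - F (t, y)‖ := by
    rw [hDim]
    refine (ContinuousLinearMap.norm_compContinuousAlternatingMap_le _ _).trans ?_
    rw [Complex.imCLM_norm, one_mul]
  have hFL := hLip p hp y hyK
  -- the pointwise inner products through the chart weight
  have hc₂' : ∀ a : EM [⋀^Fin k]→L[ℝ] ℝ, innerChart (I := 𝓘(ℝ, EM)) N k x₀ y a a ≤ (max c₂ 0) * ‖a‖ ^ 2 :=
    fun a ↦ ((hc₂ y hyK a).2).trans (mul_le_mul_of_nonneg_right (le_max_left _ _) (sq_nonneg _))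
  have h1 : MForm.inner N D.re D.re x ≤ (max c₂ 0) * (L * ‖p - t‖) ^ 2 := by
    rw [← hxy, MForm.inner_eq_innerChart D.re D.re hyt]
    refine (hc₂' _).trans ?_
    exact mul_le_mul_of_nonneg_left (pow_le_pow_left₀ (norm_nonneg _) (hre_norm.trans hFL) 2)
      (le_max_right _ _)
  have h2 : MForm.inner N D.im D.im x ≤ (max c₂ 0) * (L * ‖p - t‖) ^ 2 := by
    rw [← hxy, MForm.inner_eq_innerChart D.im D.im hyt]
    refine (hc₂' _).trans ?_
    exact mul_le_mul_of_nonneg_left (pow_le_pow_left₀ (norm_nonneg _) (him_norm.trans hFL) 2)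
      (le_max_right _ _)
  calc MForm.inner N D.re D.re x + MForm.inner N D.im D.im x
      ≤ (max c₂ 0) * (L * ‖p - t‖) ^ 2 + (max c₂ 0) * (L * ‖p - t‖) ^ 2 := add_le_add h1 h2
    _ = (max c₂ 0) * (L ^ 2 + L ^ 2) * ‖p - t‖ ^ 2 := by ring

omit [MeasurableSpace EM] [BorelSpace EM] [T2Space M] in
/-- **Uniform pointwise Lipschitz bound** on the compact `M`: there are `δ > 0` and `C` with
`⟪Re D, Re D⟫_x + ⟪Im D, Im D⟫_x ≤ C ‖p - t‖²` for all `x ∈ M` and `‖p - t‖ ≤ δ`,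
`D = Ψ_p^*Ξ - Ψ_t^*Ξ` (finitely many charts, `exists_forall_inner_pullback_sub_le_local`).
[cite: WarnerGTM94, 6.33] -/
theorem exists_forall_inner_pullback_sub_le [IT.Boundaryless] {Ψ : P → M → T} {U : Set P}
    (hU : IsOpen U) {t : P} (ht : t ∈ U)
    (hΨ : ∀ p ∈ U, ∀ x, ContMDiffAt (𝓘(ℝ, P).prod 𝓘(ℝ, EM)) IT ∞ (uncurry Ψ) (p, x))
    {k : ℕ} {Ξ : MForm IT T ℂ k} (hΞ : IsSmoothForm Ξ) :
    ∃ δ > (0 : ℝ), ∃ C : ℝ, 0 ≤ C ∧ ∀ p, ‖p - t‖ ≤ δ → ∀ x : M,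
      MForm.inner N (Ξ.pullback 𝓘(ℝ, EM) (Ψ p) - Ξ.pullback 𝓘(ℝ, EM) (Ψ t)).re
          (Ξ.pullback 𝓘(ℝ, EM) (Ψ p) - Ξ.pullback 𝓘(ℝ, EM) (Ψ t)).re x +
        MForm.inner N (Ξ.pullback 𝓘(ℝ, EM) (Ψ p) - Ξ.pullback 𝓘(ℝ, EM) (Ψ t)).im
          (Ξ.pullback 𝓘(ℝ, EM) (Ψ p) - Ξ.pullback 𝓘(ℝ, EM) (Ψ t)).im x ≤ C * ‖p - t‖ ^ 2 := by
  classical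
  choose V hV δ hδ C hC using
    fun x₀ : M ↦ exists_forall_inner_pullback_sub_le_local (N := N) hU ht hΨ hΞ x₀
  -- a finite subcover of `M` by the interiors of the `V x₀`
  obtain ⟨s, -, hs⟩ := isCompact_univ.elim_nhds_subcover (fun x₀ : M ↦ interior (V x₀))
    (fun x₀ _ ↦ interior_mem_nhds.2 (hV x₀))
  rcases s.eq_empty_or_nonempty with hse | hsne
  · -- `M` is empty
    refine ⟨1, one_pos, 0, le_rfl, fun p _ x ↦ ?_⟩
    have : x ∈ (∅ : Set M) := by
      have hx := hs (mem_univ x)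
      rw [hse] at hx
      simp at hx
    exact this.elim
  refine ⟨s.inf' hsne δ, (Finset.lt_inf'_iff hsne).2 fun x₀ _ ↦ hδ x₀,
    s.sup' hsne (fun x₀ ↦ max (C x₀) 0), ?_, fun p hp x ↦ ?_⟩
  · obtain ⟨x₀, hx₀⟩ := hsne
    exact (le_max_right _ _).trans (Finset.le_sup' (fun x₀ ↦ max (C x₀) 0) hx₀)
  obtain ⟨x₀, hx₀s, hx⟩ := mem_iUnion₂.1 (hs (mem_univ x))
  have hpδ : ‖p - t‖ ≤ δ x₀ := hp.trans (Finset.inf'_le _ hx₀s)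
  refine (hC x₀ p hpδ x (interior_subset hx)).trans ?_
  refine mul_le_mul_of_nonneg_right ?_ (sq_nonneg _)
  exact (le_max_left _ _).trans (Finset.le_sup' (fun x₀ ↦ max (C x₀) 0) hx₀s)

/-- **A smooth family of pulled-back forms is locally Lipschitz in `L²`** (Warner 6.33 pointwise,
integrated over the compact `M`; Voisin (2002), §10.2.2 setting): for `M` compact with smooth
metric and `vol_o` smooth, `Ψ : P → M → T` jointly `C^∞` on `U × M` and `Ξ` a smooth complex
`k`-form on `T`, near every `t ∈ U`: `‖Ψ_p^*Ξ - Ψ_t^*Ξ‖_{L²(M)} ≤ C ‖p - t‖`.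
[cite: WarnerGTM94, 6.33] [cite: VoisinHodgeI2002, §10.2.2] -/
theorem exists_forall_norm_mk_pullback_sub_le (ho : IsSmoothForm (riemannianVolumeForm o))
    [IT.Boundaryless] {Ψ : P → M → T} {U : Set P} (hU : IsOpen U) {t : P} (ht : t ∈ U)
    (hΨ : ∀ p ∈ U, ∀ x, ContMDiffAt (𝓘(ℝ, P).prod 𝓘(ℝ, EM)) IT ∞ (uncurry Ψ) (p, x))
    {k m : ℕ} (hkm : k + m = N) {Ξ : MForm IT T ℂ k} (hΞ : IsSmoothForm Ξ) :
    haveI : Fact (IsSmoothForm (riemannianVolumeForm o)) := ⟨ho⟩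
    ∃ C : ℝ, 0 ≤ C ∧ ∀ᶠ p in 𝓝 t,
      ∀ hs : IsSmoothForm (Ξ.pullback 𝓘(ℝ, EM) (Ψ p) - Ξ.pullback 𝓘(ℝ, EM) (Ψ t)),
        ‖CL2SmoothForms.mk o _ hs‖ ≤ C * ‖p - t‖ := by
  haveI : Fact (IsSmoothForm (riemannianVolumeForm o)) := ⟨ho⟩
  obtain ⟨δ, hδ, C, hC0, hC⟩ := exists_forall_inner_pullback_sub_le (N := N) hU ht hΨ hΞ
  set V := MForm.integral o (riemannianVolumeForm o) with hV
  have hV0 : 0 ≤ V := by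
    have h1 := integral_smul_riemannianVolumeForm_nonneg_holds o (f := fun _ ↦ (1 : ℝ))
      (fun _ ↦ zero_le_one)
    have h2 : (fun x ↦ (1 : ℝ) • riemannianVolumeForm o x) = riemannianVolumeForm o := by
      funext x; rw [one_smul]
    rw [h2] at h1
    exact h1
  refine ⟨Real.sqrt (C * V), Real.sqrt_nonneg _, ?_⟩
  filter_upwards [Metric.closedBall_mem_nhds t hδ] with p hp hs
  have hpt : ‖p - t‖ ≤ δ := by rwa [mem_closedBall, dist_eq_norm] at hp
  set D := Ξ.pullback 𝓘(ℝ, EM) (Ψ p) - Ξ.pullback 𝓘(ℝ, EM) (Ψ t) with hD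
  have hsq : ‖CL2SmoothForms.mk o D hs‖ ^ 2 ≤ (C * V) * ‖p - t‖ ^ 2 := by
    rw [CL2SmoothForms.norm_mk_sq_eq_add]
    have h := l2Inner_add_l2Inner_le_of_forall_le o ho hkm hs.re hs.im (fun x ↦ hC p hpt x)
    calc MForm.l2Inner o D.re D.re + MForm.l2Inner o D.im D.im ≤ C * ‖p - t‖ ^ 2 * V := h
      _ = C * V * ‖p - t‖ ^ 2 := by ring
  have hrhs : (C * V) * ‖p - t‖ ^ 2 = (Real.sqrt (C * V) * ‖p - t‖) ^ 2 := by
    rw [mul_pow, Real.sq_sqrt (mul_nonneg hC0 hV0)]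
  rw [hrhs] at hsq
  exact (pow_le_pow_iff_left₀ (norm_nonneg _) (mul_nonneg (Real.sqrt_nonneg _) (norm_nonneg _))
    two_ne_zero).1 hsq

end Literature.Geometry.Kaehler

end
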